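import Mathlib
import Summits.Ventures.PercRepro2.LeafRowPendantRootFO

/-!
# Row (LEAF-½) at a pendant root: the two-copy Bernstein coefficient is the sum of five
second-order pieces (blind cell PercRepro2, p5 g30; `proofs/P5-OEDGE.md` §40)

Let the root `a₂` be a LEAF with the single edge `e = {a₂, z}`.  `LeafRowEdgeCubic.Rhalf_pin_cubic`
writes `R½ = (1 − t)³R½₀ + t(1 − t)²B1h + t²(1 − t)B2h + t³R½₁` along `e`; at a pendant root
`R½₀ = 0` and `B1h ≥ 0` are theorems (`LeafRowPendantRootFO`, `LeafRowPendantRootB`).  This file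
types the SECOND-order coefficient.  Since `R½` is a homogeneous cubic form `F` in its fifteen
masses, `B2h = F(m₀, m₁, m₁) = (m₀·∇)F(m₁)` is linear in the closed-pin masses `m₀` (the isolated
root: `P(Q) = 1`, the `C₁`-masses are the unconditioned connection probabilities `π_S = P(a₁ ↔ S)`,
every `C₂`-mass vanishes) and quadratic in the open-pin masses `m₁`.  Applying `(m₀·∇)` to each
of the five pieces of `R½ = margin + crossA + crossA′ + crossB + crossB′`
(`LeafAA0.Rhalf_eq_margin_add_crossAA`) gives the five second-order pieces below, and
**`B2h_eq_so`** is the dictionary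

  `B2h = crossAso + crossA′so + marginso + crossBso + crossB′so`

(the closed-pin scalars are flip-invariant, `KPrime.flipInvAt_*`; the open-pin masses are the
`Q`-pattern masses; then `ring1` — the identity was pre-checked as a free polynomial identity in
the 34 atoms, own code `mining/p5/g30/sym/check_dict2.py`).  In `Q`-expectations
(`X = L_o − π_o`, `Y = L_b − π_b`, `Z = P(Q)`):

* `crossAso = 2Z·E_Q[H_v X Y] − E_Q[H_v X]·E_Q[Y] − E_Q[H_v Y]·E_Q[X]`;
* `crossBso = 2Z·E_Q[H_o(1 − H_v)(π_b − L_b)] + E_Q[H_o]·E_Q[H_v(π_b − L_b)] − E_Q[H_o(1 − H_v)]·E_Q[π_b − L_b]`;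
* `crossA′so = 2Z·E_Q[L_v H_o H_b] − E_Q[H_b]·E_Q[L_v H_o] − E_Q[H_o]·E_Q[L_v H_b] + π_v·E_Q[H_o]·E_Q[H_b]`;
* `crossB′so = Z·E_Q[H_b(π_o − 2L_o − π_o L_v − π_{ov} + 2L_o L_v)] + E_Q[H_b]·E_Q[L_o + π_o L_v + π_v L_o − L_o L_v] − E_Q[L_o]·E_Q[H_b L_v]`;
* `marginso = (1 − π_v)·[anticov(oH, bL) + anticov(oL, bH)] + (Z − m_v)·[slack_o + slack_b]`.

The signs of `marginso`, `crossAso`, `crossBso` are settled in `LeafRowPendantRootSOSign.lean`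
(positive association of the explored cluster `C(a₂)`, `bhk_univ_avoid`); nothing in this file
claims a sign.  Own work; standard axioms.
-/

namespace Summit.Ventures.PercRepro2

open UnionCluster CovForm CovForm.FirstOrder CovForm.EdgeLine LeafStep LeafHalfCross
  LeafRowEdgeCubic LeafRowFirstOrderA LeafRowPendantRootFO

namespace LeafRowPendantRootSO

section Pieces

variable {V : Type*} {E : Type*} [Fintype E] [DecidableEq E] {R : Type*} [Field R]

/-- The second-order (A)-term:
`2Z·P(Q, vH, oL, bL) − P(Q, bL)·P(Q, vH, oL) − π_b·Z·P(Q, vH, oL) + π_o·P(Q, vH)·P(Q, bL)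
 − π_o·Z·P(Q, vH, bL) + π_b·P(Q, oL)·P(Q, vH) − P(Q, oL)·P(Q, vH, bL)`. -/
noncomputable def crossAso (q : E → R) (ends : E → Sym2 V) (o a₁ a₂ v b : V) : R :=
  2 * prob q (avoidAll ends a₂ {a₁}) *
      prob q (avoidAll ends a₂ {a₁} ∩ (connEvent ends a₂ v ∩ (connEvent ends a₁ o ∩ connEvent ends a₁ b))) -
    prob q (avoidAll ends a₂ {a₁} ∩ connEvent ends a₁ b) *
      prob q (avoidAll ends a₂ {a₁} ∩ (connEvent ends a₂ v ∩ connEvent ends a₁ o)) -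
    prob q (connEvent ends a₁ b) * prob q (avoidAll ends a₂ {a₁}) *
      prob q (avoidAll ends a₂ {a₁} ∩ (connEvent ends a₂ v ∩ connEvent ends a₁ o)) +
    prob q (connEvent ends a₁ o) * prob q (avoidAll ends a₂ {a₁} ∩ connEvent ends a₂ v) *
      prob q (avoidAll ends a₂ {a₁} ∩ connEvent ends a₁ b) -
    prob q (connEvent ends a₁ o) * prob q (avoidAll ends a₂ {a₁}) *
      prob q (avoidAll ends a₂ {a₁} ∩ (connEvent ends a₂ v ∩ connEvent ends a₁ b)) +
    prob q (connEvent ends a₁ b) * prob q (avoidAll ends a₂ {a₁} ∩ connEvent ends a₁ o) *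
      prob q (avoidAll ends a₂ {a₁} ∩ connEvent ends a₂ v) -
    prob q (avoidAll ends a₂ {a₁} ∩ connEvent ends a₁ o) *
      prob q (avoidAll ends a₂ {a₁} ∩ (connEvent ends a₂ v ∩ connEvent ends a₁ b))

/-- The second-order (B)-term:
`P(Q, oH)·P(Q, bL) + π_b·Z·P(Q, oH) − 2Z·P(Q, oH, bL) + π_b·P(Q, oH)·P(Q, vH) − P(Q, oH)·P(Q, vH, bL)
 − P(Q, bL)·P(Q, vH, oH) − π_b·Z·P(Q, vH, oH) + 2Z·P(Q, vH, oH, bL)`. -/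
noncomputable def crossBso (q : E → R) (ends : E → Sym2 V) (o a₁ a₂ v b : V) : R :=
  prob q (avoidAll ends a₂ {a₁} ∩ connEvent ends a₂ o) * prob q (avoidAll ends a₂ {a₁} ∩ connEvent ends a₁ b) +
    prob q (connEvent ends a₁ b) * prob q (avoidAll ends a₂ {a₁}) *
      prob q (avoidAll ends a₂ {a₁} ∩ connEvent ends a₂ o) -
    2 * prob q (avoidAll ends a₂ {a₁}) *
      prob q (avoidAll ends a₂ {a₁} ∩ (connEvent ends a₂ o ∩ connEvent ends a₁ b)) +
    prob q (connEvent ends a₁ b) * prob q (avoidAll ends a₂ {a₁} ∩ connEvent ends a₂ o) *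
      prob q (avoidAll ends a₂ {a₁} ∩ connEvent ends a₂ v) -
    prob q (avoidAll ends a₂ {a₁} ∩ connEvent ends a₂ o) *
      prob q (avoidAll ends a₂ {a₁} ∩ (connEvent ends a₂ v ∩ connEvent ends a₁ b)) -
    prob q (avoidAll ends a₂ {a₁} ∩ connEvent ends a₁ b) *
      prob q (avoidAll ends a₂ {a₁} ∩ (connEvent ends a₂ v ∩ connEvent ends a₂ o)) -
    prob q (connEvent ends a₁ b) * prob q (avoidAll ends a₂ {a₁}) *
      prob q (avoidAll ends a₂ {a₁} ∩ (connEvent ends a₂ v ∩ connEvent ends a₂ o)) +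
    2 * prob q (avoidAll ends a₂ {a₁}) *
      prob q (avoidAll ends a₂ {a₁} ∩ (connEvent ends a₂ v ∩ (connEvent ends a₂ o ∩ connEvent ends a₁ b)))

/-- The second-order mirror (A)-term:
`2Z·P(Q, vL, oH, bH) − P(Q, bH)·P(Q, vL, oH) + π_v·P(Q, oH)·P(Q, bH) − P(Q, oH)·P(Q, vL, bH)`. -/
noncomputable def crossA'so (q : E → R) (ends : E → Sym2 V) (o a₁ a₂ v b : V) : R :=
  2 * prob q (avoidAll ends a₂ {a₁}) *
      prob q (avoidAll ends a₂ {a₁} ∩ (connEvent ends a₁ v ∩ (connEvent ends a₂ o ∩ connEvent ends a₂ b))) -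
    prob q (avoidAll ends a₂ {a₁} ∩ connEvent ends a₂ b) *
      prob q (avoidAll ends a₂ {a₁} ∩ (connEvent ends a₁ v ∩ connEvent ends a₂ o)) +
    prob q (connEvent ends a₁ v) * prob q (avoidAll ends a₂ {a₁} ∩ connEvent ends a₂ o) *
      prob q (avoidAll ends a₂ {a₁} ∩ connEvent ends a₂ b) -
    prob q (avoidAll ends a₂ {a₁} ∩ connEvent ends a₂ o) *
      prob q (avoidAll ends a₂ {a₁} ∩ (connEvent ends a₁ v ∩ connEvent ends a₂ b))

/-- The second-order mirror (B)-term: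
`P(Q, oL)·P(Q, bH) + π_o·Z·P(Q, bH) − 2Z·P(Q, oL, bH) + π_o·P(Q, vL)·P(Q, bH) + π_v·P(Q, oL)·P(Q, bH)
 − P(Q, oL)·P(Q, vL, bH) − π_o·Z·P(Q, vL, bH) − P(Q, bH)·P(Q, vL, oL) − π_{vo}·Z·P(Q, bH) + 2Z·P(Q, vL, oL, bH)`. -/
noncomputable def crossB'so (q : E → R) (ends : E → Sym2 V) (o a₁ a₂ v b : V) : R :=
  prob q (avoidAll ends a₂ {a₁} ∩ connEvent ends a₁ o) * prob q (avoidAll ends a₂ {a₁} ∩ connEvent ends a₂ b) +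
    prob q (connEvent ends a₁ o) * prob q (avoidAll ends a₂ {a₁}) *
      prob q (avoidAll ends a₂ {a₁} ∩ connEvent ends a₂ b) -
    2 * prob q (avoidAll ends a₂ {a₁}) *
      prob q (avoidAll ends a₂ {a₁} ∩ (connEvent ends a₁ o ∩ connEvent ends a₂ b)) +
    prob q (connEvent ends a₁ o) * prob q (avoidAll ends a₂ {a₁} ∩ connEvent ends a₁ v) *
      prob q (avoidAll ends a₂ {a₁} ∩ connEvent ends a₂ b) +
    prob q (connEvent ends a₁ v) * prob q (avoidAll ends a₂ {a₁} ∩ connEvent ends a₁ o) *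
      prob q (avoidAll ends a₂ {a₁} ∩ connEvent ends a₂ b) -
    prob q (avoidAll ends a₂ {a₁} ∩ connEvent ends a₁ o) *
      prob q (avoidAll ends a₂ {a₁} ∩ (connEvent ends a₁ v ∩ connEvent ends a₂ b)) -
    prob q (connEvent ends a₁ o) * prob q (avoidAll ends a₂ {a₁}) *
      prob q (avoidAll ends a₂ {a₁} ∩ (connEvent ends a₁ v ∩ connEvent ends a₂ b)) -
    prob q (avoidAll ends a₂ {a₁} ∩ connEvent ends a₂ b) *
      prob q (avoidAll ends a₂ {a₁} ∩ (connEvent ends a₁ v ∩ connEvent ends a₁ o)) -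
    prob q (connEvent ends a₁ v ∩ connEvent ends a₁ o) * prob q (avoidAll ends a₂ {a₁}) *
      prob q (avoidAll ends a₂ {a₁} ∩ connEvent ends a₂ b) +
    2 * prob q (avoidAll ends a₂ {a₁}) *
      prob q (avoidAll ends a₂ {a₁} ∩ (connEvent ends a₁ v ∩ (connEvent ends a₁ o ∩ connEvent ends a₂ b)))

/-- The second-order margin:
`(1 − π_v)·[anticov(oH, bL) + anticov(oL, bH)] + (Z − P(Q, vL) − P(Q, vH))·[(π_b·P(Q, oH) − P(Q, oH, bL)) + (π_o·P(Q, bH) − P(Q, oL, bH))]`. -/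
noncomputable def marginso (q : E → R) (ends : E → Sym2 V) (o a₁ a₂ v b : V) : R :=
  (1 - prob q (connEvent ends a₁ v)) *
      ((prob q (avoidAll ends a₂ {a₁} ∩ connEvent ends a₂ o) * prob q (avoidAll ends a₂ {a₁} ∩ connEvent ends a₁ b) -
          prob q (avoidAll ends a₂ {a₁}) *
            prob q (avoidAll ends a₂ {a₁} ∩ (connEvent ends a₂ o ∩ connEvent ends a₁ b))) +
        (prob q (avoidAll ends a₂ {a₁} ∩ connEvent ends a₁ o) * prob q (avoidAll ends a₂ {a₁} ∩ connEvent ends a₂ b) -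
          prob q (avoidAll ends a₂ {a₁}) *
            prob q (avoidAll ends a₂ {a₁} ∩ (connEvent ends a₁ o ∩ connEvent ends a₂ b)))) +
    (prob q (avoidAll ends a₂ {a₁}) - prob q (avoidAll ends a₂ {a₁} ∩ connEvent ends a₁ v) -
        prob q (avoidAll ends a₂ {a₁} ∩ connEvent ends a₂ v)) *
      ((prob q (connEvent ends a₁ b) * prob q (avoidAll ends a₂ {a₁} ∩ connEvent ends a₂ o) -
          prob q (avoidAll ends a₂ {a₁} ∩ (connEvent ends a₂ o ∩ connEvent ends a₁ b))) +
        (prob q (connEvent ends a₁ o) * prob q (avoidAll ends a₂ {a₁} ∩ connEvent ends a₂ b) -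
          prob q (avoidAll ends a₂ {a₁} ∩ (connEvent ends a₁ o ∩ connEvent ends a₂ b))))

end Pieces

section Dictionary

variable {V : Type*} {E : Type*} [Fintype E] [DecidableEq E] [Fintype V] [DecidableEq V]
  {R : Type*} [Field R] [LinearOrder R] [IsStrictOrderedRing R]
variable {ends : E → Sym2 V} {p : E → R} {e : E} {a₂ z : V}

omit [Fintype V] in
/-- **THE SECOND-ORDER DICTIONARY**: at a pendant root edge `e = {a₂, z}`, the two-copy Bernstein
coefficient of `R½` is the sum of the five second-order pieces at the open pin. -/
theorem B2h_eq_so (he : p e ≠ 1) (hleaf : ∀ f, a₂ ∈ ends f → f = e) (hends : ends e = s(a₂, z))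
    {o a₁ v b : V} (ho : o ≠ a₂) (h1 : a₁ ≠ a₂) (hv : v ≠ a₂) (hb : b ≠ a₂) :
    B2h p ends o a₁ a₂ v b e =
      crossAso (Function.update p e 1) ends o a₁ a₂ v b +
        crossA'so (Function.update p e 1) ends o a₁ a₂ v b +
        marginso (Function.update p e 1) ends o a₁ a₂ v b +
        crossBso (Function.update p e 1) ends o a₁ a₂ v b +
        crossB'so (Function.update p e 1) ends o a₁ a₂ v b := by
  -- the closed-pin scalars are flip-invariant: `P₁ = P₀` on the `a₂`-free events
  have fc : ∀ x : V, x ≠ a₂ → prob (Function.update p e 1) (connEvent ends a₁ x) =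
      prob (Function.update p e 0) (connEvent ends a₁ x) := fun x hx =>
    KPrime.prob_update_one_eq_update_zero_of_flipInvAt he (KPrime.flipInvAt_connEvent hleaf hends h1 hx)
  have fcc : ∀ x y : V, x ≠ a₂ → y ≠ a₂ →
      prob (Function.update p e 1) (connEvent ends a₁ x ∩ connEvent ends a₁ y) =
      prob (Function.update p e 0) (connEvent ends a₁ x ∩ connEvent ends a₁ y) := fun x y hx hy =>
    KPrime.prob_update_one_eq_update_zero_of_flipInvAt he
      ((KPrime.flipInvAt_connEvent hleaf hends h1 hx).inter (KPrime.flipInvAt_connEvent hleaf hends h1 hy))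
  have fccc : prob (Function.update p e 1)
        (connEvent ends a₁ v ∩ (connEvent ends a₁ o ∩ connEvent ends a₁ b)) =
      prob (Function.update p e 0)
        (connEvent ends a₁ v ∩ (connEvent ends a₁ o ∩ connEvent ends a₁ b)) :=
    KPrime.prob_update_one_eq_update_zero_of_flipInvAt he
      ((KPrime.flipInvAt_connEvent hleaf hends h1 hv).inter
        ((KPrime.flipInvAt_connEvent hleaf hends h1 ho).inter (KPrime.flipInvAt_connEvent hleaf hends h1 hb)))
  have hvX : ∀ x ∈ ({v} : Finset V), x ≠ a₂ := fun x hx => by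
    rw [Finset.mem_singleton] at hx; rw [hx]; exact hv
  have fa : prob (Function.update p e 1) (avoidAll ends a₁ {v}) =
      prob (Function.update p e 0) (avoidAll ends a₁ {v}) :=
    KPrime.prob_update_one_eq_update_zero_of_flipInvAt he (KPrime.flipInvAt_avoidAll hleaf hends h1 hvX)
  have fa1 : ∀ x : V, x ≠ a₂ → prob (Function.update p e 1) (avoidAll ends a₁ {v} ∩ connEvent ends a₁ x) =
      prob (Function.update p e 0) (avoidAll ends a₁ {v} ∩ connEvent ends a₁ x) := fun x hx =>
    KPrime.prob_update_one_eq_update_zero_of_flipInvAt he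
      ((KPrime.flipInvAt_avoidAll hleaf hends h1 hvX).inter (KPrime.flipInvAt_connEvent hleaf hends h1 hx))
  have fa2 : prob (Function.update p e 1) (avoidAll ends a₁ {v} ∩ (connEvent ends a₁ o ∩ connEvent ends a₁ b)) =
      prob (Function.update p e 0) (avoidAll ends a₁ {v} ∩ (connEvent ends a₁ o ∩ connEvent ends a₁ b)) :=
    KPrime.prob_update_one_eq_update_zero_of_flipInvAt he
      ((KPrime.flipInvAt_avoidAll hleaf hends h1 hvX).inter
        ((KPrime.flipInvAt_connEvent hleaf hends h1 ho).inter (KPrime.flipInvAt_connEvent hleaf hends h1 hb)))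
  -- the split relations at the open pin
  have s1 := split_a₃ (ends := ends) (Function.update p e 1) a₁ v (connEvent ends a₁ o)
  have s2 := split_a₃ (ends := ends) (Function.update p e 1) a₁ v (connEvent ends a₁ b)
  have s3 := split_a₃ (ends := ends) (Function.update p e 1) a₁ v (connEvent ends a₁ o ∩ connEvent ends a₁ b)
  have s4 := split_a₃ (ends := ends) (Function.update p e 1) a₁ v Set.univ
  rw [Set.inter_univ, Set.inter_univ, prob_univ] at s4
  -- assemble
  unfold B2h
  rw [closed_Q hleaf h1, closed_EQbo hleaf ho h1 hb v, closed_EQb3 hleaf h1 hv hb,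
    closed_EQb3o hleaf ho h1 hv hb, closed_EQo hleaf ho h1 v, closed_EQ3 hleaf h1 hv,
    closed_EQ3o hleaf ho h1 hv, closed_PDb hleaf h1 hv hb, closed_PDbo hleaf ho h1 hv hb,
    closed_Do hleaf ho h1 hv, closed_gap hleaf h1 hb v, closed_mU hleaf h1 ho, closed_mU hleaf h1 hb,
    closed_mU hleaf h1 hv, closed_mUU hleaf ho h1 hb]
  rw [← fc o ho, ← fc b hb, ← fc v hv, ← fcc v o hv ho, ← fcc v b hv hb, ← fccc, ← fcc o b ho hb,
    ← fa, ← fa1 o ho, ← fa1 b hb, ← fa2]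
  rw [show prob (Function.update p e 1) (avoidAll ends a₁ {v} ∩ connEvent ends a₁ o) =
      prob (Function.update p e 1) (connEvent ends a₁ o) -
        prob (Function.update p e 1) (connEvent ends a₁ v ∩ connEvent ends a₁ o) by linarith,
    show prob (Function.update p e 1) (avoidAll ends a₁ {v} ∩ connEvent ends a₁ b) =
      prob (Function.update p e 1) (connEvent ends a₁ b) -
        prob (Function.update p e 1) (connEvent ends a₁ v ∩ connEvent ends a₁ b) by linarith,
    show prob (Function.update p e 1) (avoidAll ends a₁ {v} ∩ (connEvent ends a₁ o ∩ connEvent ends a₁ b)) =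
      prob (Function.update p e 1) (connEvent ends a₁ o ∩ connEvent ends a₁ b) -
        prob (Function.update p e 1) (connEvent ends a₁ v ∩ (connEvent ends a₁ o ∩ connEvent ends a₁ b)) by
      linarith,
    show prob (Function.update p e 1) (avoidAll ends a₁ {v}) =
      1 - prob (Function.update p e 1) (connEvent ends a₁ v) by linarith]
  unfold B2hPoly crossAso crossA'so marginso crossBso crossB'so
  delta EQbo EQb3 EQb3o EQo EQ3 EQ3o PDb PDbo Do mU mUU
  rw [gap_eq_Q]
  simp only [prob_T_inter_v (Function.update p e 1) ends a₁ a₂ v,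
    prob_T'_inter_v (Function.update p e 1) ends a₁ a₂ v,
    prob_PD_inter_v (Function.update p e 1) ends a₁ a₂ v, prob_T_v (Function.update p e 1) ends a₁ a₂ v,
    prob_T'_v (Function.update p e 1) ends a₁ a₂ v]
  ring1

end Dictionary

end LeafRowPendantRootSO

end Summit.Ventures.PercRepro2
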